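import Summits.AtomisticToContinuum.Crystallization.Theorems.OverbindingBudgetAffineCompressedCutKernel

/-!
# Overbinding budget — compressed cut: kernel tables III (two-parent stacking `UP2`, hcp parent layers)

Kernel-computed tables (`decide +kernel`) for the exact adjacency kernel (read through `kernelTwoB_sound`),
hcp parent layers `H`, `H′` (companion of `…KernelStackF`):

| parent | side | fcc child | hcp child |
|---|---|---|---|
| `H` | above | `F⁺` | `H′` |
| `H` | below | `F⁻` | `H′` |
| `H′` | above | `F⁻` | `H` |
| `H′` | below | `F⁺` | `H` |

No `sorry`, no new axioms.
-/

namespace Summit.AtomisticToContinuum.Crystallization.Theorems.OverbindingBudgetAffineCompressedCutKernel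

/-- UP2: parent layer `H`, child above, fcc ⇒ `F⁺`. [this file, by `decide +kernel`] -/
theorem up_hcp_pos_fcc : kernelTwoB hcpL 1 fccL [fccL] = true := by decide +kernel
/-- UP2: parent layer `H`, child above, hcp ⇒ `H′`. [this file, by `decide +kernel`] -/
theorem up_hcp_pos_hcp : kernelTwoB hcpL 1 hcpL [hcpAltL] = true := by decide +kernel
/-- UP2: parent layer `H`, child below, fcc ⇒ `F⁻`. [this file, by `decide +kernel`] -/
theorem up_hcp_neg_fcc : kernelTwoB hcpL (-1) fccL [fccNegL] = true := by decide +kernel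
/-- UP2: parent layer `H`, child below, hcp ⇒ `H′`. [this file, by `decide +kernel`] -/
theorem up_hcp_neg_hcp : kernelTwoB hcpL (-1) hcpL [hcpAltL] = true := by decide +kernel
/-- UP2: parent layer `H′`, child above, fcc ⇒ `F⁻`. [this file, by `decide +kernel`] -/
theorem up_hcpAlt_pos_fcc : kernelTwoB hcpAltL 1 fccL [fccNegL] = true := by decide +kernel
/-- UP2: parent layer `H′`, child above, hcp ⇒ `H`. [this file, by `decide +kernel`] -/
theorem up_hcpAlt_pos_hcp : kernelTwoB hcpAltL 1 hcpL [hcpL] = true := by decide +kernel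
/-- UP2: parent layer `H′`, child below, fcc ⇒ `F⁺`. [this file, by `decide +kernel`] -/
theorem up_hcpAlt_neg_fcc : kernelTwoB hcpAltL (-1) fccL [fccL] = true := by decide +kernel
/-- UP2: parent layer `H′`, child below, hcp ⇒ `H`. [this file, by `decide +kernel`] -/
theorem up_hcpAlt_neg_hcp : kernelTwoB hcpAltL (-1) hcpL [hcpL] = true := by decide +kernel

end Summit.AtomisticToContinuum.Crystallization.Theorems.OverbindingBudgetAffineCompressedCutKernel
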